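import Mathlib
import Summits.NavierStokesRegularity.NavierStokesRegularity.Theorems.EulerZoomLiouvillePowerGaugeEulerLiouvilleWeakSupportDensityBootstrap
import Summits.NavierStokesRegularity.NavierStokesRegularity.Theorems.EulerZoomLiouvillePowerGaugeEulerLiouvilleWeakSupportLaw
import HarnessLib

/-!
# Crux `EulerZoomLiouville.PowerGaugeEulerLiouville` (stmt-NavierStokesRegularity-19832), weak stratum, line `weak_eulerian` (ns-idea-11 g9):
# THE SUPPORT-DENSITY LAW — `stub_supportDensityLaw` (E3) filled

Route №10 `EulerZoomLiouville` (NavierStokesRegularity), crux E = stmt-NavierStokesRegularity-19832; width seat ns-ezl-w1 g8 under the LEAD ns-typeII-p2 g15.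
A weak exactly self-similar class member whose a.e. vorticity `Ω = curlCLM ∘ G` is a RENORMALISED solution of the similarity transport equation
(`HasRenormalisedVorticity`, DiPerna–Lions/Eulerian, line stub E2) and is supported on a set of ASYMPTOTIC DENSITY ZERO is trivial — for EVERY
`ρ ∈ (0, ½]`, with NO flow (M1) and NO Lagrangian Kelvin (M2):

* `hasFDerivAt_betaR`, `fderiv_betaR_apply`, `contDiff_betaR`, `betaR_bounds` — the saturating renormalisation `β_δ(w) = ‖w‖²(δ + ‖w‖²)⁻¹`
  (`C¹`, `|β_δ| ≤ 1`, `‖Dβ_δ‖ ≤ 1 + δ⁻¹`, `Dβ_δ(w)[h] = 2δ⟪w,h⟫/(δ+‖w‖²)²`);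
* `supportLaw_of_renormalised` — **THE FLOW-FREE SUPPORT LAW**: renormalisation with `β_δ`, `δ ↓ 0` (dominated convergence; the stretching term is
  killed by `|Dβ_δ(Ω)[Ω − GΩ]| ≤ 1 + ‖G‖`, `→ 0` pointwise) ⇒ `∫ 1_{Ω≠0} (3γψ + Dψ[W]) = 0` for every test `ψ`, i.e. `div(W·1_{Ω≠0}) = 3γ·1_{Ω≠0}`;
* `supportDensityLaw` — **`Sig.stub_supportDensityLaw` of `Lines/weak_eulerian.lean` δ-unfolded** (fill: `intro ρ hρ hρh u p H c V P G hcl hss hG hdiv hren hΘ;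
  exact WeakEulerian.supportDensityLaw hρ hρh hcl hss hG hdiv hren hΘ`): support law for a measurable representative of `{Ω ≠ 0}`, the set-form
  support-density law `measure_eq_zero_of_supportLaw_of_density` (T2, p697486: Cauchy–Schwarz + `A`-gauge growth + bootstrap `3 → 1−ρ → −3ρ/2`) ⇒
  `Ω = 0` a.e. ⇒ `G` a.e. symmetric and trace-free with growth `1 − 2ρ < 3` ⇒ `V = 0` a.e. (`ae_eq_zero_of_symm_traceFree_of_growth`) ⇒ `u = 0` a.e.
[folklore; DiPernaLions1989 Thm II.1/II.2 (renormalised solutions); the Eulerian port of Chae 2007 Cor. 1 = arXiv:math/0601661 p.3]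

WHAT THIS IS NOT: not NS, not E, not E2 (`stub_renormalisation`, the DiPerna–Lions commutator port) — 19832 is OPEN.
-/

noncomputable section

-- flat `Theorems/<Route><Decl>…` files of one crux share the namespace of the crux (tree convention)
set_option linter.dupNamespace false

open MeasureTheory Set Filter Topology Metric Function TopologicalSpace
open scoped ENNReal NNReal RealInnerProductSpace ContDiff

namespace Summit.NavierStokesRegularity.NavierStokesRegularity.Theorems.PowerGaugeEulerLiouville.WeakEulerian

open Literature.Analysis Literature.Analysis.FunctionSpaces Literature.Analysis.FluidPDE
open Summit.NavierStokesRegularity.NavierStokesRegularity.Theorems.PowerGaugeEulerLiouville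

/-! ### The saturating renormalisation `β_δ(w) = ‖w‖²(δ + ‖w‖²)⁻¹` -/

section Beta

variable {δ : ℝ}

/-- `Dβ_δ(w) = ‖w‖²·D((δ+‖·‖²)⁻¹) + (δ+‖w‖²)⁻¹·D(‖·‖²)` (product/chain rule). -/
theorem hasFDerivAt_betaR (hδ : 0 < δ) (w : EuclideanSpace ℝ (Fin 3)) :
    HasFDerivAt (fun w : EuclideanSpace ℝ (Fin 3) => ‖w‖ ^ 2 * (δ + ‖w‖ ^ 2)⁻¹)
      (‖w‖ ^ 2 • (ContinuousLinearMap.toSpanSingleton ℝ (-((δ + ‖w‖ ^ 2) ^ 2)⁻¹)).comp ((2 : ℝ) • innerSL ℝ w) +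
        (δ + ‖w‖ ^ 2)⁻¹ • ((2 : ℝ) • innerSL ℝ w)) w := by
  have hD : 0 < δ + ‖w‖ ^ 2 := by positivity
  have hN : HasFDerivAt (fun w : EuclideanSpace ℝ (Fin 3) => ‖w‖ ^ 2) ((2 : ℝ) • innerSL ℝ w) w :=
    (hasStrictFDerivAt_norm_sq w).hasFDerivAt.congr_fderiv (by rw [two_nsmul, two_smul])
  have hDen : HasFDerivAt (fun w : EuclideanSpace ℝ (Fin 3) => δ + ‖w‖ ^ 2) ((2 : ℝ) • innerSL ℝ w) w := hN.const_add δ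
  have hInv : HasFDerivAt (fun w : EuclideanSpace ℝ (Fin 3) => (δ + ‖w‖ ^ 2)⁻¹)
      ((ContinuousLinearMap.toSpanSingleton ℝ (-((δ + ‖w‖ ^ 2) ^ 2)⁻¹)).comp ((2 : ℝ) • innerSL ℝ w)) w :=
    (hasFDerivAt_inv hD.ne').comp w hDen
  exact hN.mul hInv

/-- **`Dβ_δ(w)[h] = 2δ⟪w,h⟫/(δ + ‖w‖²)²`.** -/
theorem fderiv_betaR_apply (hδ : 0 < δ) (w h : EuclideanSpace ℝ (Fin 3)) :
    fderiv ℝ (fun w : EuclideanSpace ℝ (Fin 3) => ‖w‖ ^ 2 * (δ + ‖w‖ ^ 2)⁻¹) w h = 2 * δ / (δ + ‖w‖ ^ 2) ^ 2 * ⟪w, h⟫ := by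
  have hD : 0 < δ + ‖w‖ ^ 2 := by positivity
  rw [(hasFDerivAt_betaR hδ w).fderiv]
  simp only [add_apply, smul_apply, ContinuousLinearMap.coe_comp, Function.comp_apply,
    innerSL_apply_apply, ContinuousLinearMap.toSpanSingleton_apply, smul_eq_mul]
  field_simp
  ring

/-- `β_δ ∈ C¹`. -/
theorem contDiff_betaR (hδ : 0 < δ) : ContDiff ℝ 1 fun w : EuclideanSpace ℝ (Fin 3) => ‖w‖ ^ 2 * (δ + ‖w‖ ^ 2)⁻¹ :=
  (contDiff_norm_sq ℝ).mul ((contDiff_const.add (contDiff_norm_sq ℝ)).inv fun w => by positivity)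

/-- `0 ≤ β_δ ≤ 1` and `‖Dβ_δ(w)‖ ≤ 1 + δ⁻¹` (`2δ‖w‖ ≤ δ(1 + ‖w‖²) ≤ (1 + δ⁻¹)(δ + ‖w‖²)²`). -/
theorem betaR_bounds (hδ : 0 < δ) (w : EuclideanSpace ℝ (Fin 3)) :
    ‖‖w‖ ^ 2 * (δ + ‖w‖ ^ 2)⁻¹‖ ≤ 1 + δ⁻¹ ∧
      ‖fderiv ℝ (fun w : EuclideanSpace ℝ (Fin 3) => ‖w‖ ^ 2 * (δ + ‖w‖ ^ 2)⁻¹) w‖ ≤ 1 + δ⁻¹ := by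
  have hD : 0 < δ + ‖w‖ ^ 2 := by positivity
  have hδi : 0 < δ⁻¹ := inv_pos.2 hδ
  constructor
  · rw [Real.norm_of_nonneg (by positivity), ← div_eq_mul_inv]
    exact (div_le_one hD).2 (by linarith) |>.trans (by linarith)
  · refine ContinuousLinearMap.opNorm_le_bound _ (by positivity) fun h => ?_
    rw [fderiv_betaR_apply hδ, Real.norm_eq_abs, abs_mul, abs_of_nonneg (by positivity : 0 ≤ 2 * δ / (δ + ‖w‖ ^ 2) ^ 2)]
    have h1 : |⟪w, h⟫| ≤ ‖w‖ * ‖h‖ := abs_real_inner_le_norm w h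
    have h2 : 2 * δ / (δ + ‖w‖ ^ 2) ^ 2 * ‖w‖ ≤ 1 + δ⁻¹ := by
      rw [div_mul_eq_mul_div, div_le_iff₀ (by positivity)]
      have h3 : 2 * ‖w‖ ≤ 1 + ‖w‖ ^ 2 := by nlinarith [sq_nonneg (‖w‖ - 1)]
      have h4 : 2 * δ * ‖w‖ ≤ δ * (1 + ‖w‖ ^ 2) := by nlinarith
      have h5 : δ * (1 + ‖w‖ ^ 2) ≤ (1 + δ⁻¹) * (δ + ‖w‖ ^ 2) ^ 2 := by
        have e : (1 + δ⁻¹) * (δ + ‖w‖ ^ 2) ^ 2 = (δ + 1) * (δ + ‖w‖ ^ 2) * ((δ + ‖w‖ ^ 2) / δ) := by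
          field_simp
        rw [e]
        have h6 : 1 ≤ (δ + ‖w‖ ^ 2) / δ := by rw [le_div_iff₀ hδ]; nlinarith
        nlinarith [mul_nonneg (by positivity : (0 : ℝ) ≤ (δ + 1) * (δ + ‖w‖ ^ 2)) (sub_nonneg.2 h6)]
      linarith
    calc 2 * δ / (δ + ‖w‖ ^ 2) ^ 2 * |⟪w, h⟫| ≤ 2 * δ / (δ + ‖w‖ ^ 2) ^ 2 * (‖w‖ * ‖h‖) :=
          mul_le_mul_of_nonneg_left h1 (by positivity)
      _ = 2 * δ / (δ + ‖w‖ ^ 2) ^ 2 * ‖w‖ * ‖h‖ := by ring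
      _ ≤ (1 + δ⁻¹) * ‖h‖ := mul_le_mul_of_nonneg_right h2 (norm_nonneg _)

end Beta

/-! ### The flow-free support law from renormalisation -/

section SupportLaw

variable {γ : ℝ} {V : EuclideanSpace ℝ (Fin 3) → EuclideanSpace ℝ (Fin 3)}
  {G : EuclideanSpace ℝ (Fin 3) → EuclideanSpace ℝ (Fin 3) →L[ℝ] EuclideanSpace ℝ (Fin 3)}

/-- A continuous compactly supported form field paired with a locally integrable vector field is integrable. -/
theorem integrable_clm_apply_of_locallyIntegrable {L : EuclideanSpace ℝ (Fin 3) → EuclideanSpace ℝ (Fin 3) →L[ℝ] ℝ}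
    {W : EuclideanSpace ℝ (Fin 3) → EuclideanSpace ℝ (Fin 3)} (hL : Continuous L) (hLs : HasCompactSupport L)
    (hW : LocallyIntegrable W volume) : Integrable (fun y => L y (W y)) volume := by
  have hm : AEStronglyMeasurable (fun y => L y (W y)) volume :=
    Continuous.comp_aestronglyMeasurable₂ (g := fun (L : EuclideanSpace ℝ (Fin 3) →L[ℝ] ℝ) (v : EuclideanSpace ℝ (Fin 3)) => L v)
      (isBoundedBilinearMap_apply (𝕜 := ℝ) (E := EuclideanSpace ℝ (Fin 3)) (F := ℝ)).continuous hL.aestronglyMeasurable hW.aestronglyMeasurable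
  have hWn : LocallyIntegrable (fun y => ‖W y‖) volume := fun x => (hW x).norm
  refine Integrable.mono' (hWn.integrable_smul_left_of_hasCompactSupport hL.norm hLs.norm) hm (Eventually.of_forall fun y => ?_)
  rw [smul_eq_mul]
  exact (L y).le_opNorm (W y)

/-- **THE FLOW-FREE SUPPORT LAW.**  If `Ω = curlCLM ∘ G` (`G ∈ L¹_loc`) is a renormalised solution — for every `β ∈ C¹` bounded with bounded derivative and
every test `ψ`, `∫ β(Ω)(3γψ + Dψ[W]) = ∫ ψ Dβ(Ω)[Ω − GΩ]`, `W = γy + V`, `V ∈ L¹_loc` — then `∫ 1_{Ω≠0}(3γψ + Dψ[W]) = 0` for every test `ψ`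
(`β_δ → 1_{≠0}`, `Dβ_δ(Ω)[Ω − GΩ] → 0` dominatedly). -/
theorem supportLaw_of_renormalised (hVl : LocallyIntegrable V volume) (hGl : LocallyIntegrable G volume)
    (hren : ∀ β : EuclideanSpace ℝ (Fin 3) → ℝ, ContDiff ℝ 1 β → (∃ C : ℝ, ∀ w, ‖β w‖ ≤ C ∧ ‖fderiv ℝ β w‖ ≤ C) →
      ∀ ψ : EuclideanSpace ℝ (Fin 3) → ℝ, IsTestFunctionOn (⊤ : Opens (EuclideanSpace ℝ (Fin 3))) ψ →
        ∫ y, β (curlCLM (G y)) * (3 * γ * ψ y + fderiv ℝ ψ y (selfSimilarTransport γ 0 V y)) =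
          ∫ y, ψ y * fderiv ℝ β (curlCLM (G y)) (curlCLM (G y) - G y (curlCLM (G y))))
    {ψ : EuclideanSpace ℝ (Fin 3) → ℝ} (hψ : IsTestFunctionOn (⊤ : Opens (EuclideanSpace ℝ (Fin 3))) ψ) :
    ∫ y, (if curlCLM (G y) = 0 then (0 : ℝ) else 1) * (3 * γ * ψ y + fderiv ℝ ψ y (selfSimilarTransport γ 0 V y)) = 0 := by
  -- ### notation and measurability
  set Ω : EuclideanSpace ℝ (Fin 3) → EuclideanSpace ℝ (Fin 3) := fun y => curlCLM (G y) with hΩ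
  set W : EuclideanSpace ℝ (Fin 3) → EuclideanSpace ℝ (Fin 3) := selfSimilarTransport γ 0 V with hW
  have hGm : AEStronglyMeasurable G volume := hGl.aestronglyMeasurable
  have hΩm : AEStronglyMeasurable Ω volume := curlCLM.continuous.comp_aestronglyMeasurable hGm
  have hGΩm : AEStronglyMeasurable (fun y => G y (Ω y)) volume :=
    Continuous.comp_aestronglyMeasurable₂
      (g := fun (L : EuclideanSpace ℝ (Fin 3) →L[ℝ] EuclideanSpace ℝ (Fin 3)) (v : EuclideanSpace ℝ (Fin 3)) => L v)
      (isBoundedBilinearMap_apply (𝕜 := ℝ) (E := EuclideanSpace ℝ (Fin 3)) (F := EuclideanSpace ℝ (Fin 3))).continuous hGm hΩm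
  have hWl : LocallyIntegrable W volume := by
    have h1 : LocallyIntegrable (fun y : EuclideanSpace ℝ (Fin 3) => γ • (y - 0)) volume :=
      ((continuous_id.sub continuous_const).const_smul γ).locallyIntegrable
    exact h1.add hVl
  -- the test-side function `A = 3γψ + Dψ[W]` is integrable
  have hψc : Continuous ψ := hψ.contDiff.continuous
  have hψi : Integrable ψ volume := hψc.integrable_of_hasCompactSupport hψ.hasCompactSupport
  have hA : Integrable (fun y => 3 * γ * ψ y + fderiv ℝ ψ y (W y)) volume :=
    (hψi.const_mul _).add (integrable_clm_apply_of_locallyIntegrable (hψ.contDiff.continuous_fderiv (by simp))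
      (hψ.hasCompactSupport.fderiv (𝕜 := ℝ)) hWl)
  -- ### the sequence `δₙ = 1/(n+1)`
  set d : ℕ → ℝ := fun n => 1 / ((n : ℝ) + 1) with hd
  have hdpos : ∀ n, 0 < d n := fun n => by rw [hd]; positivity
  have hdlim : Tendsto d atTop (𝓝 0) := tendsto_one_div_add_atTop_nhds_zero_nat
  -- the renormalisation identity for `β_{δₙ}`
  have hid : ∀ n : ℕ, ∫ y, ‖Ω y‖ ^ 2 * (d n + ‖Ω y‖ ^ 2)⁻¹ * (3 * γ * ψ y + fderiv ℝ ψ y (W y)) =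
      ∫ y, ψ y * (2 * d n / (d n + ‖Ω y‖ ^ 2) ^ 2 * ⟪Ω y, Ω y - G y (Ω y)⟫) := by
    intro n
    have h := hren (fun w => ‖w‖ ^ 2 * (d n + ‖w‖ ^ 2)⁻¹) (contDiff_betaR (hdpos n))
      ⟨1 + (d n)⁻¹, fun w => betaR_bounds (hdpos n) w⟩ ψ hψ
    simp_rw [fderiv_betaR_apply (hdpos n)] at h
    exact h
  -- ### left side: dominated convergence to `∫ 1_{Ω≠0} A`
  have hL : Tendsto (fun n : ℕ => ∫ y, ‖Ω y‖ ^ 2 * (d n + ‖Ω y‖ ^ 2)⁻¹ * (3 * γ * ψ y + fderiv ℝ ψ y (W y))) atTop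
      (𝓝 (∫ y, (if Ω y = 0 then (0 : ℝ) else 1) * (3 * γ * ψ y + fderiv ℝ ψ y (W y)))) := by
    refine tendsto_integral_of_dominated_convergence (fun y => ‖3 * γ * ψ y + fderiv ℝ ψ y (W y)‖) (fun n => ?_) hA.norm
      (fun n => Eventually.of_forall fun y => ?_) (Eventually.of_forall fun y => ?_)
    · exact (((contDiff_betaR (hdpos n)).continuous.comp_aestronglyMeasurable hΩm).mul hA.aestronglyMeasurable)
    · rw [norm_mul]
      have hdn := hdpos n
      refine mul_le_of_le_one_left (norm_nonneg _) ?_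
      rw [Real.norm_of_nonneg (by positivity), ← div_eq_mul_inv]
      exact (div_le_one (by positivity)).2 (by linarith)
    · refine Tendsto.mul_const _ ?_
      by_cases hy : Ω y = 0
      · simp [hy]
      · have hpos : 0 < ‖Ω y‖ ^ 2 := by positivity
        rw [if_neg hy]
        have h := ((hdlim.add_const (‖Ω y‖ ^ 2)).inv₀ (by positivity)).const_mul (‖Ω y‖ ^ 2)
        rw [zero_add, mul_inv_cancel₀ hpos.ne'] at h
        exact h
  -- ### right side: dominated convergence to `0`
  have hR : Tendsto (fun n : ℕ => ∫ y, ψ y * (2 * d n / (d n + ‖Ω y‖ ^ 2) ^ 2 * ⟪Ω y, Ω y - G y (Ω y)⟫)) atTop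
      (𝓝 (∫ _y : EuclideanSpace ℝ (Fin 3), (0 : ℝ))) := by
    have hGn : LocallyIntegrable (fun y => 1 + ‖G y‖) volume := fun x => (locallyIntegrable_const (μ := (volume : Measure (EuclideanSpace ℝ (Fin 3)))) (1 : ℝ) x).add (hGl x).norm
    have hbound : Integrable (fun y => ‖ψ y‖ • (1 + ‖G y‖)) volume :=
      hGn.integrable_smul_left_of_hasCompactSupport hψc.norm hψ.hasCompactSupport.norm
    refine tendsto_integral_of_dominated_convergence (fun y => ‖ψ y‖ • (1 + ‖G y‖)) (fun n => ?_) hbound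
      (fun n => Eventually.of_forall fun y => ?_) (Eventually.of_forall fun y => ?_)
    · have hdn := hdpos n
      refine hψc.aestronglyMeasurable.mul (AEStronglyMeasurable.mul ?_ (hΩm.inner (hΩm.sub hGΩm)))
      have hne : ∀ w : EuclideanSpace ℝ (Fin 3), (d n + ‖w‖ ^ 2) ^ 2 ≠ 0 := fun w => by positivity
      have hc : Continuous fun w : EuclideanSpace ℝ (Fin 3) => 2 * d n / (d n + ‖w‖ ^ 2) ^ 2 :=
        continuous_const.div ((continuous_const.add (continuous_norm.pow 2)).pow 2) hne
      exact hc.comp_aestronglyMeasurable hΩm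
    · -- `|ψ · 2δ⟪Ω, Ω − GΩ⟫/(δ+‖Ω‖²)²| ≤ |ψ| (1 + ‖G‖)`
      rw [norm_mul, smul_eq_mul]
      refine mul_le_mul_of_nonneg_left ?_ (norm_nonneg _)
      have hD : 0 < d n + ‖Ω y‖ ^ 2 := by positivity
      have h1 : |⟪Ω y, Ω y - G y (Ω y)⟫| ≤ ‖Ω y‖ ^ 2 * (1 + ‖G y‖) := by
        calc |⟪Ω y, Ω y - G y (Ω y)⟫| ≤ ‖Ω y‖ * ‖Ω y - G y (Ω y)‖ := abs_real_inner_le_norm _ _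
          _ ≤ ‖Ω y‖ * (‖Ω y‖ + ‖G y‖ * ‖Ω y‖) :=
              mul_le_mul_of_nonneg_left ((norm_sub_le _ _).trans (add_le_add le_rfl ((G y).le_opNorm _))) (norm_nonneg _)
          _ = ‖Ω y‖ ^ 2 * (1 + ‖G y‖) := by ring
      have h2 : 2 * d n / (d n + ‖Ω y‖ ^ 2) ^ 2 * ‖Ω y‖ ^ 2 ≤ 1 := by
        rw [div_mul_eq_mul_div, div_le_one (by positivity)]
        nlinarith [sq_nonneg (d n - ‖Ω y‖ ^ 2), hdpos n]
      rw [Real.norm_eq_abs, abs_mul, abs_of_nonneg (by positivity : 0 ≤ 2 * d n / (d n + ‖Ω y‖ ^ 2) ^ 2)]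
      calc 2 * d n / (d n + ‖Ω y‖ ^ 2) ^ 2 * |⟪Ω y, Ω y - G y (Ω y)⟫|
          ≤ 2 * d n / (d n + ‖Ω y‖ ^ 2) ^ 2 * (‖Ω y‖ ^ 2 * (1 + ‖G y‖)) := mul_le_mul_of_nonneg_left h1 (by positivity)
        _ = 2 * d n / (d n + ‖Ω y‖ ^ 2) ^ 2 * ‖Ω y‖ ^ 2 * (1 + ‖G y‖) := by ring
        _ ≤ 1 * (1 + ‖G y‖) := mul_le_mul_of_nonneg_right h2 (by positivity)
        _ = 1 + ‖G y‖ := one_mul _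
    · by_cases hy : Ω y = 0
      · simp [hy]
      · have hpos : 0 < ‖Ω y‖ ^ 2 := by positivity
        have h := ((hdlim.const_mul 2).div ((hdlim.add_const (‖Ω y‖ ^ 2)).pow 2) (by positivity)).mul_const
          ⟪Ω y, Ω y - G y (Ω y)⟫ |>.const_mul (ψ y)
        simpa using h
  -- ### conclusion
  rw [integral_zero] at hR
  have hL' : Tendsto (fun n : ℕ => ∫ y, ‖Ω y‖ ^ 2 * (d n + ‖Ω y‖ ^ 2)⁻¹ * (3 * γ * ψ y + fderiv ℝ ψ y (W y))) atTop (𝓝 0) := by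
    simp_rw [hid]; exact hR
  exact tendsto_nhds_unique hL hL'

end SupportLaw

/-! ### The member-level law (the line's stub E3, δ-unfolded) -/

section Member

/-- **`stub_supportDensityLaw` (E3) of `Lines/weak_eulerian.lean`**, with `InClass`, `IsExactlySelfSimilar`, `IsProfileGradient`, `HasTransportDivergence`,
`HasRenormalisedVorticity`, `supportDensity`, `transportW` δ-unfolded (the line fills it by
`intro ρ hρ hρh u p H c V P G hcl hss hG hdiv hren hΘ; exact WeakEulerian.supportDensityLaw hρ hρh hcl hss hG hdiv hren hΘ`):
a weak exactly self-similar class member (any `ρ ∈ (0,½]`) whose a.e. vorticity `curlCLM ∘ G` is a renormalised solution of the similarity transport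
equation and whose vorticity support has asymptotic density zero, `vol({curlCLM ∘ G ≠ 0} ∩ B_R)/vol(B_R) → 0`, is trivial.
The divergence clause `div W = 3γ` is part of the stub's binder and not used. [folklore; DiPernaLions1989 §II; Chae 2007 Cor. 1] -/
theorem supportDensityLaw {ρ : ℝ} (hρ : 0 < ρ) (hρh : ρ ≤ 1 / 2)
    {u : ℝ → EuclideanSpace ℝ (Fin 3) → EuclideanSpace ℝ (Fin 3)} {p : ℝ → EuclideanSpace ℝ (Fin 3) → ℝ}
    {H : ℝ → EuclideanSpace ℝ (Fin 3) → EuclideanSpace ℝ (Fin 3) →L[ℝ] EuclideanSpace ℝ (Fin 3)} {c : ℝ≥0}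
    {V : EuclideanSpace ℝ (Fin 3) → EuclideanSpace ℝ (Fin 3)} {P : EuclideanSpace ℝ (Fin 3) → ℝ}
    {G : EuclideanSpace ℝ (Fin 3) → EuclideanSpace ℝ (Fin 3) →L[ℝ] EuclideanSpace ℝ (Fin 3)}
    (hcls : IsSuitableWeakSolutionOn (slab (EuclideanSpace ℝ (Fin 3)) (Set.Iio 0) isOpen_Iio) 0 0 u p ∧
      HasWeakSpatialGradientOn (slab (EuclideanSpace ℝ (Fin 3)) (Set.Iio 0) isOpen_Iio) u H ∧
      (∀ a : ℝ, 0 < a →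
        ENNReal.ofReal (a ^ (2 * ρ)) * cknA a (0 : ℝ × EuclideanSpace ℝ (Fin 3)) u +
            ENNReal.ofReal (a ^ ρ) * cknE a (0 : ℝ × EuclideanSpace ℝ (Fin 3)) H +
          ENNReal.ofReal (a ^ (2 * ρ)) * cknD a (0 : ℝ × EuclideanSpace ℝ (Fin 3)) p ≤ (c : ℝ≥0∞)))
    (hss : (∀ τ : ℝ, τ < 0 → u τ = selfSimilarCollapse (1 / (2 + ρ)) 0 V τ) ∧
      (∀ τ : ℝ, τ < 0 → p τ = selfSimilarCollapsePressure (1 / (2 + ρ)) 0 P τ))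
    (hPG : HasWeakFDerivOn (⊤ : Opens (EuclideanSpace ℝ (Fin 3))) volume V G ∧
      (∀ r : ℝ, MemLp G 2 (volume.restrict (ball (0 : EuclideanSpace ℝ (Fin 3)) r))) ∧
      (∀ r : ℝ, MemLp V 6 (volume.restrict (ball (0 : EuclideanSpace ℝ (Fin 3)) r))) ∧
      HasWeakFDerivOn (⊤ : Opens (EuclideanSpace ℝ (Fin 3))) volume (selfSimilarTransport (1 / (2 + ρ)) 0 V)
        (fun x => (1 / (2 + ρ)) • ContinuousLinearMap.id ℝ (EuclideanSpace ℝ (Fin 3)) + G x))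
    (_hdiv : ∀ φ : EuclideanSpace ℝ (Fin 3) → ℝ, IsTestFunctionOn (⊤ : Opens (EuclideanSpace ℝ (Fin 3))) φ →
      ∫ y, inner ℝ (selfSimilarTransport (1 / (2 + ρ)) 0 V y) (gradient φ y) = -(3 * (1 / (2 + ρ))) * ∫ y, φ y)
    (hren : ∀ β : EuclideanSpace ℝ (Fin 3) → ℝ, ContDiff ℝ 1 β → (∃ C : ℝ, ∀ w : EuclideanSpace ℝ (Fin 3), ‖β w‖ ≤ C ∧ ‖fderiv ℝ β w‖ ≤ C) →
      ∀ ψ : EuclideanSpace ℝ (Fin 3) → ℝ, IsTestFunctionOn (⊤ : Opens (EuclideanSpace ℝ (Fin 3))) ψ →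
        ∫ y, β (curlCLM (G y)) * (3 * (1 / (2 + ρ)) * ψ y + fderiv ℝ ψ y (selfSimilarTransport (1 / (2 + ρ)) 0 V y)) =
          ∫ y, ψ y * fderiv ℝ β (curlCLM (G y)) (curlCLM (G y) - G y (curlCLM (G y))))
    (hΘ : Tendsto (fun R : ℝ => (volume : Measure (EuclideanSpace ℝ (Fin 3)))
        ({y : EuclideanSpace ℝ (Fin 3) | curlCLM (G y) ≠ 0} ∩ ball (0 : EuclideanSpace ℝ (Fin 3)) R) /
          (volume : Measure (EuclideanSpace ℝ (Fin 3))) (ball (0 : EuclideanSpace ℝ (Fin 3)) R)) atTop (𝓝 0)) :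
    Function.uncurry u =ᵐ[volume.restrict (Set.Iio (0 : ℝ) ×ˢ (Set.univ : Set (EuclideanSpace ℝ (Fin 3))))] 0 := by
  obtain ⟨hsw, hH, hgauge⟩ := hcls
  obtain ⟨hu, hp⟩ := hss
  obtain ⟨hVG, -, hV6, -⟩ := hPG
  -- ### class data
  have hA : ∀ a : ℝ, 0 < a → ENNReal.ofReal (a ^ (2 * ρ)) *
      cknA a (0 : ℝ × EuclideanSpace ℝ (Fin 3)) u ≤ (c : ℝ≥0∞) :=
    fun a ha => le_trans (le_trans le_self_add le_self_add) (hgauge a ha)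
  have hE : ∀ a : ℝ, 0 < a → ENNReal.ofReal (a ^ ρ) *
      cknE a (0 : ℝ × EuclideanSpace ℝ (Fin 3)) H ≤ (c : ℝ≥0∞) :=
    fun a ha => le_trans (le_trans le_add_self le_self_add) (hgauge a ha)
  have hD : ∀ a : ℝ, 0 < a → ENNReal.ofReal (a ^ (2 * ρ)) *
      cknD a (0 : ℝ × EuclideanSpace ℝ (Fin 3)) p ≤ (c : ℝ≥0∞) :=
    fun a ha => le_trans le_add_self (hgauge a ha)
  have hu' : ∀ τ : ℝ, τ < 0 → u τ = fun x => selfSimilarCollapse (1 / (2 + ρ)) 0 V τ (x - 0) :=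
    fun τ hτ => by rw [hu τ hτ]; funext x; rw [sub_zero]
  have hp' : ∀ τ : ℝ, τ < 0 → p τ = fun x => selfSimilarCollapsePressure (1 / (2 + ρ)) 0 P τ (x - 0) :=
    fun τ hτ => by rw [hp τ hτ]; funext x; rw [sub_zero]
  obtain ⟨G', hVm, -, -, -, -, ⟨CA, hCA, hAgr⟩, -, -, -, -, -, hdivV, -, -, -⟩ :=
    Past.profileData_of_past hρ hρh le_rfl le_rfl 0 hsw.distributional hH hA hE hD hu' hp'
  have hVl : LocallyIntegrable V volume := locallyIntegrableOn_univ.1 (by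
    simpa only [Opens.coe_top] using hVG.locallyIntegrableOn)
  have hGl : LocallyIntegrable G volume := locallyIntegrableOn_univ.1 (by
    simpa only [Opens.coe_top] using hVG.locallyIntegrableOn_deriv)
  have hGm : AEStronglyMeasurable G volume := hGl.aestronglyMeasurable
  have hγ : (0 : ℝ) < 1 / (2 + ρ) := by positivity
  -- `V ∈ L²_loc`
  have hV2 : ∀ r : ℝ, MemLp V 2 (volume.restrict (ball (0 : EuclideanSpace ℝ (Fin 3)) r)) := fun r => by
    haveI : IsFiniteMeasure ((volume : Measure (EuclideanSpace ℝ (Fin 3))).restrict (ball (0 : EuclideanSpace ℝ (Fin 3)) r)) :=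
      isFiniteMeasure_restrict.2 measure_ball_lt_top.ne
    exact (hV6 r).mono_exponent (by norm_num)
  -- the `A`-gauge growth in real form
  have hAreal : ∀ L : ℝ, 2 ≤ L → ∫ y in ball (0 : EuclideanSpace ℝ (Fin 3)) L, ‖V y‖ ^ 2 ≤ CA.toReal * L ^ (1 - 2 * ρ) := by
    intro L hL
    have hint : IntegrableOn (fun y => ‖V y‖ ^ 2) (ball (0 : EuclideanSpace ℝ (Fin 3)) L) volume := (hV2 L).integrable_norm_pow two_ne_zero
    have e : ∫ y in ball (0 : EuclideanSpace ℝ (Fin 3)) L, ‖V y‖ ^ 2 =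
        (∫⁻ y in ball (0 : EuclideanSpace ℝ (Fin 3)) L, ‖V y‖ₑ ^ 2).toReal := by
      rw [integral_eq_lintegral_of_nonneg_ae (Eventually.of_forall fun y => by positivity) hint.aestronglyMeasurable]
      congr 1
      refine lintegral_congr fun y => ?_
      rw [← ofReal_norm, ENNReal.ofReal_pow (norm_nonneg _)]
    rw [e, ← ENNReal.toReal_ofReal (by positivity : 0 ≤ L ^ (1 - 2 * ρ)), ← ENNReal.toReal_mul]
    exact ENNReal.toReal_mono (ENNReal.mul_ne_top hCA ENNReal.ofReal_ne_top) (hAgr L (by linarith))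
  -- ### a measurable representative of the vorticity and its support
  set Ω : EuclideanSpace ℝ (Fin 3) → EuclideanSpace ℝ (Fin 3) := fun y => curlCLM (G y) with hΩ
  have hΩm : AEStronglyMeasurable Ω volume := curlCLM.continuous.comp_aestronglyMeasurable hGm
  set Ω' : EuclideanSpace ℝ (Fin 3) → EuclideanSpace ℝ (Fin 3) := hΩm.mk Ω with hΩ'
  have hΩΩ' : Ω =ᵐ[volume] Ω' := hΩm.ae_eq_mk
  set S : Set (EuclideanSpace ℝ (Fin 3)) := {y | Ω' y ≠ 0} with hS
  have hSm : MeasurableSet S := hΩm.stronglyMeasurable_mk.measurable (measurableSet_singleton 0).compl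
  -- ### the support law for `S`
  have hlaw : ∀ ψ : EuclideanSpace ℝ (Fin 3) → ℝ, IsTestFunctionOn (⊤ : Opens (EuclideanSpace ℝ (Fin 3))) ψ →
      ∫ y in S, (3 * (1 / (2 + ρ)) * ψ y + fderiv ℝ ψ y (selfSimilarTransport (1 / (2 + ρ)) 0 V y)) = 0 := by
    intro ψ hψ
    have h := supportLaw_of_renormalised (γ := 1 / (2 + ρ)) hVl hGl hren hψ
    rw [← integral_indicator hSm, ← h]
    refine integral_congr_ae ?_
    filter_upwards [hΩΩ'] with y hy
    by_cases hyS : y ∈ S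
    · rw [indicator_of_mem hyS]
      have hne : Ω y ≠ 0 := by rw [hy]; exact hyS
      rw [if_neg hne, one_mul]
    · rw [indicator_of_notMem hyS]
      have heq : Ω y = 0 := by rw [hy]; by_contra h'; exact hyS h'
      rw [if_pos heq, zero_mul]
  -- ### the density of `S` tends to zero
  have hdens : Tendsto (fun R : ℝ => volume (S ∩ ball (0 : EuclideanSpace ℝ (Fin 3)) R) / volume (ball (0 : EuclideanSpace ℝ (Fin 3)) R))
      atTop (𝓝 0) := by
    have hN : volume {y | Ω y ≠ Ω' y} = 0 := by
      have := hΩΩ'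
      rw [Filter.EventuallyEq, ae_iff] at this
      exact this
    have hle : ∀ R : ℝ, volume (S ∩ ball (0 : EuclideanSpace ℝ (Fin 3)) R) ≤
        volume ({y : EuclideanSpace ℝ (Fin 3) | curlCLM (G y) ≠ 0} ∩ ball (0 : EuclideanSpace ℝ (Fin 3)) R) := by
      intro R
      have hsub : S ∩ ball (0 : EuclideanSpace ℝ (Fin 3)) R ⊆
          ({y : EuclideanSpace ℝ (Fin 3) | curlCLM (G y) ≠ 0} ∩ ball (0 : EuclideanSpace ℝ (Fin 3)) R) ∪ {y | Ω y ≠ Ω' y} := by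
        rintro y ⟨hyS, hyB⟩
        by_cases h : Ω y = Ω' y
        · left; exact ⟨by rw [mem_setOf_eq, show curlCLM (G y) = Ω y from rfl, h]; exact hyS, hyB⟩
        · right; exact h
      calc volume (S ∩ ball (0 : EuclideanSpace ℝ (Fin 3)) R)
          ≤ volume ({y : EuclideanSpace ℝ (Fin 3) | curlCLM (G y) ≠ 0} ∩ ball (0 : EuclideanSpace ℝ (Fin 3)) R) + volume {y | Ω y ≠ Ω' y} :=
            (measure_mono hsub).trans (measure_union_le _ _)
        _ = _ := by rw [hN, add_zero]
    exact tendsto_of_tendsto_of_tendsto_of_le_of_le tendsto_const_nhds hΘ (fun _ => zero_le) fun R =>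
      ENNReal.div_le_div_right (hle R) _
  -- ### the set-form support-density law: `vol S = 0`
  have hS0 : volume S = 0 :=
    measure_eq_zero_of_supportLaw_of_density (S := S) hγ hρ hVl hV2 ENNReal.toReal_nonneg hAreal hlaw hdens
  -- ### the vorticity vanishes a.e.
  have hcurl : ∀ᵐ y ∂(volume : Measure (EuclideanSpace ℝ (Fin 3))), curlCLM (G y) = 0 := by
    have h1 : ∀ᵐ y ∂(volume : Measure (EuclideanSpace ℝ (Fin 3))), y ∉ S := measure_eq_zero_iff_ae_notMem.1 hS0
    filter_upwards [h1, hΩΩ'] with y hy hy'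
    have : Ω' y = 0 := by by_contra h; exact hy h
    rw [show curlCLM (G y) = Ω y from rfl, hy', this]
  -- ### symmetric, trace-free weak gradient with `A`-growth ⇒ `V = 0` a.e.
  have hsym : ∀ᵐ x ∂(volume : Measure (EuclideanSpace ℝ (Fin 3))), ∀ v w : EuclideanSpace ℝ (Fin 3), ⟪G x v, w⟫ = ⟪G x w, v⟫ := by
    filter_upwards [hcurl] with x hx
    exact WeakConfinedVorticity.symm_of_curlCLM_eq_zero hx
  have htr : ∀ᵐ x ∂(volume : Measure (EuclideanSpace ℝ (Fin 3))), ∑ j, G x (EuclideanSpace.single j (1 : ℝ)) j = 0 := by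
    filter_upwards [hdivV.trace_weakGradient_ae_eq_zero hVG] with x hx
    rw [LinearMap.trace_eq_sum_inner _ (EuclideanSpace.basisFun (Fin 3) ℝ)] at hx
    simpa [EuclideanSpace.basisFun_apply, EuclideanSpace.inner_single_left] using hx
  have hgrowth : ∀ r : ℝ, 2 < r → 0 < r →
      ∫⁻ x in ball (0 : EuclideanSpace ℝ (Fin 3)) r, ‖V x‖ₑ ^ 2 ≤ ENNReal.ofReal (CA.toReal * r ^ (1 - 2 * ρ)) := by
    intro r hr _
    rw [ENNReal.ofReal_mul ENNReal.toReal_nonneg, ENNReal.ofReal_toReal hCA]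
    exact hAgr r (by linarith)
  have hV0 : V =ᵐ[volume] 0 :=
    ae_eq_zero_of_symm_traceFree_of_growth hVG hsym htr (K := CA.toReal) (m := 1 - 2 * ρ) (r₀ := 2) (by linarith) hgrowth
  -- ### the member is trivial
  exact Past.ae_eq_zero_of_profile_ae_eq_zero (γ := 1 / (2 + ρ)) hρ.le le_rfl hsw hH hgauge hu' hV0

end Member

end Summit.NavierStokesRegularity.NavierStokesRegularity.Theorems.PowerGaugeEulerLiouville.WeakEulerian

end
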